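import Literature.IUT.LogVolume.Corollary22ThetaClosureField
import Literature.IUT.LogVolume.ThetaFieldReading
import HarnessLib

/-!
# The theta closure field `F‡(P)` satisfies the datum's pinning clause `Cor22.IsSubThetaField`

[IUTchIV] Thm. 1.10, p. 22: "`F = F_mod(√−1, E_{F_mod}[2·3·5]) := F_tpd(√−1, E_{F_tpd}[3·5])` — i.e., `F` is obtained from
`F_tpd` by adjoining `√−1`, together with the fields of definition of the `(3·5)`-torsion points of a model `E_{F_tpd}` …
determined by the Legendre form". In the cell's model reading v3 (abc-iut-plan 2026-08-26T02:33:05Z / 02:59:03Z) the field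
of the Θ-data at a point `P = (F_tpd, λ)` is abc-iut-L5-t7's THETA CLOSURE FIELD `Cor22.thetaClosureField P = F_tpd(√−1, √λ,
√(λ−1), E_λ[3·5]) ⊆ F̄_tpd` (`Corollary22ThetaClosureField.lean`), and the Θ-volume datum `Cor22.ThetaVolumeDatumAt P l` (v3)
pins its field `F` by the predicate `Cor22.IsSubThetaField P F` (`ThetaFieldReading.lean`: `F` is generated over `F_tpd` by
square roots of `−1, λ, λ−1` and coordinates of `F`-rational `15`-torsion points of the Legendre curve).

This proof-only file discharges that clause for `F := F‡(P)`:

* **`Cor22.isSubThetaField_thetaClosureField (hU : P.InU) : IsSubThetaField P (thetaClosureField P)`** — every generator of `F‡(P)`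
  (a square root in `F̄_tpd` of `−1, λ, λ−1`, or a coordinate of a `15`-torsion point of `E_λ(F̄_tpd)`), read as an
  element of `F‡(P)`, IS an admissible generator in the sense of `Cor22.subThetaFieldGenerators P F‡(P)` (the torsion
  point descends to an `F‡(P)`-rational `15`-torsion point of `E_λ ⊗ F‡(P)`, abc-iut-S-d1's `exists_torsionPoint_baseChange`),
  and `F‡(P)` is the `F_tpd`-adjoin of its generators by definition — the same `adjoin_induction` as S-d1's
  `exists_isThetaField`.

So the intended inhabitant of the v3 datum satisfies the pinning field (route `IUTThetaPilot`, child (i) of the crux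
`ThetaPartII`: L5-t7's (P7) constructor supplies the initial Θ-data over `F‡(P)`, this file the `isSubThetaField` clause).
Classical; TAKES NO SIDE on anything disputed. [cite: Mochizuki2012, IUTchIV Thm. 1.10 p. 22] (claim key, disputed).
-/

noncomputable section

open scoped Classical

namespace Literature.IUT.LogVolume

namespace Cor22

open NumberField Literature.NumberTheory.DiophantineGeometry.GenEll
open Literature.NumberTheory.EllipticCurves WeierstrassCurve IntermediateField

variable (P : NFPoint)

/-- A square-root generator of `F‡(P)`, read in `F‡(P)`, is an admissible generator: its square is `−1`, `λ` or `λ − 1`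
(in `F‡(P)`). [claim: Mochizuki2012, status: disputed] -/
theorem mem_subThetaFieldGenerators_of_mem_thetaClosureRoots (hU : P.InU) {z : AlgebraicClosure P.F}
    (hz : z ∈ thetaClosureRoots P) (hzF : z ∈ thetaClosureField P) :
    haveI : Fact P.InU := ⟨hU⟩
    (⟨z, hzF⟩ : thetaClosureField P) ∈ subThetaFieldGenerators P (thetaClosureField P) := by
  haveI : Fact P.InU := ⟨hU⟩
  obtain ⟨a, ha, hza⟩ := Set.mem_iUnion₂.1 hz
  have hza' : z ^ 2 = algebraMap P.F (AlgebraicClosure P.F) a := hza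
  left
  simp only [thetaClosureRadicands, Set.mem_insert_iff, Set.mem_singleton_iff] at ha
  rcases ha with rfl | rfl | rfl
  · left
    apply Subtype.ext
    simp [hza']
  · right; left
    apply Subtype.ext
    simpa using hza'
  · right; right
    apply Subtype.ext
    simpa using hza'

/-- A torsion-coordinate generator of `F‡(P)`, read in `F‡(P)`, is an admissible generator: the `15`-torsion point of
`E_λ(F̄_tpd)` it belongs to has both coordinates in `F‡(P)` and descends to an `F‡(P)`-rational `15`-torsion point of
`E_λ ⊗ F‡(P)` (abc-iut-S-d1's `exists_torsionPoint_baseChange`). [claim: Mochizuki2012, status: disputed] -/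
theorem mem_subThetaFieldGenerators_of_mem_thetaClosureTorsionCoords (hU : P.InU) {z : AlgebraicClosure P.F}
    (hz : z ∈ thetaClosureTorsionCoords P) (hzF : z ∈ thetaClosureField P) :
    haveI : Fact P.InU := ⟨hU⟩
    (⟨z, hzF⟩ : thetaClosureField P) ∈ subThetaFieldGenerators P (thetaClosureField P) := by
  haveI : Fact P.InU := ⟨hU⟩
  -- the `DecidableEq` instance under which `torsionCoords_eq` was elaborated (plain classical, not `Subtype`'s)
  letI instF : DecidableEq (thetaClosureField P) := fun a b => Classical.propDecidable (a = b)
  right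
  rw [torsionCoords_eq P (thetaClosureField P)]
  obtain ⟨T, hT, hzT⟩ := Set.mem_iUnion₂.1 hz
  have hT' : (15 : ℤ) • T = 0 := hT
  rcases T with _ | ⟨a, b, hab⟩
  · simp [pointCoords] at hzT
  · have haF : a ∈ thetaClosureField P := coords_mem_thetaClosureField P hT' (by simp [pointCoords])
    have hbF : b ∈ thetaClosureField P := coords_mem_thetaClosureField P hT' (by simp [pointCoords])
    obtain ⟨TF, h15, haT, hbT⟩ :=
      exists_torsionPoint_baseChange P.legendreCurve (thetaClosureField P) haF hbF hab hT'
    refine Set.mem_iUnion₂.2 ⟨TF, h15, ?_⟩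
    simp only [pointCoords, Set.mem_insert_iff, Set.mem_singleton_iff] at hzT
    rcases hzT with hxa | hxb
    · have hxe : (⟨z, hzF⟩ : thetaClosureField P) = ⟨a, haF⟩ := Subtype.ext hxa
      rw [hxe]; exact haT
    · have hxe : (⟨z, hzF⟩ : thetaClosureField P) = ⟨b, hbF⟩ := Subtype.ext hxb
      rw [hxe]; exact hbT

/-- Every generator of `F‡(P)`, read in `F‡(P)`, is an admissible generator of the datum's pinning clause.
[claim: Mochizuki2012, status: disputed] -/
theorem mem_subThetaFieldGenerators_of_mem_thetaClosureGens (hU : P.InU) {z : AlgebraicClosure P.F}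
    (hz : z ∈ thetaClosureGens P) (hzF : z ∈ thetaClosureField P) :
    haveI : Fact P.InU := ⟨hU⟩
    (⟨z, hzF⟩ : thetaClosureField P) ∈ subThetaFieldGenerators P (thetaClosureField P) := by
  rcases hz with hz | hz
  · exact mem_subThetaFieldGenerators_of_mem_thetaClosureRoots P hU hz hzF
  · exact mem_subThetaFieldGenerators_of_mem_thetaClosureTorsionCoords P hU hz hzF

/-- **`F‡(P)` satisfies the v3 pinning clause of the Θ-volume datum: `IsSubThetaField P (thetaClosureField P)`** —
`F‡(P)` is generated over `F_tpd` by admissible generators (it is the `F_tpd`-adjoin of its generators by definition, and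
each of them is admissible when read in `F‡(P)`). Hence abc-iut-L5-t7's initial Θ-data over `F‡(P)` inhabit
`Cor22.ThetaVolumeDatumAt P l` (v3) as far as the field clause is concerned. [cite: Mochizuki2012, IUTchIV Thm. 1.10 p. 22] -/
theorem isSubThetaField_thetaClosureField (hU : P.InU) :
    haveI : Fact P.InU := ⟨hU⟩
    IsSubThetaField P (thetaClosureField P) := by
  haveI : Fact P.InU := ⟨hU⟩
  refine ⟨?_⟩
  rw [eq_top_iff]
  rintro ⟨ω, hω⟩ -
  induction hω using adjoin_induction with
  | mem x hx =>
    exact subset_adjoin P.F _ (mem_subThetaFieldGenerators_of_mem_thetaClosureGens P hU hx _)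
  | algebraMap k =>
    have : (⟨algebraMap P.F (AlgebraicClosure P.F) k, IntermediateField.algebraMap_mem _ k⟩ :
        thetaClosureField P) = algebraMap P.F (thetaClosureField P) k :=
      Subtype.ext rfl
    rw [this]
    exact IntermediateField.algebraMap_mem _ k
  | add x y hx hy ihx ihy =>
    have : (⟨x + y, add_mem hx hy⟩ : thetaClosureField P) = ⟨x, hx⟩ + ⟨y, hy⟩ := rfl
    rw [this]
    exact add_mem ihx ihy
  | inv x hx ihx =>
    have : (⟨x⁻¹, inv_mem hx⟩ : thetaClosureField P) = (⟨x, hx⟩ : thetaClosureField P)⁻¹ := rfl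
    rw [this]
    exact inv_mem ihx
  | mul x y hx hy ihx ihy =>
    have : (⟨x * y, mul_mem hx hy⟩ : thetaClosureField P) = ⟨x, hx⟩ * ⟨y, hy⟩ := rfl
    rw [this]
    exact mul_mem ihx ihy

end Cor22

end Literature.IUT.LogVolume

end
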